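import Summits.CriticalPhenomena.SAWScalingLimit.Theses.SAWMassiveIsingTilt
import Summits.CriticalPhenomena.SAWScalingLimit.Theorems.SAWMassiveIsingTiltDefs
import Literature.Probability.RandomPlanarGeometry.ConformalRestrictionHolds
import Literature.Probability.RandomPlanarGeometry.ConformalRestrictionLocal
import Literature.Probability.RandomPlanarGeometry.HullRestrictionSLEHolds
import Literature.Probability.RandomPlanarGeometry.CritPercSLESimplePathHolds
import Literature.Probability.RandomPlanarGeometry.SLEExistenceNeEightHolds
import Summits.CriticalPhenomena.SAWScalingLimit.Theorems.SAWRenewalTightnessSubseqIdentificationRestrictionPassage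
import Mathlib.MeasureTheory.Measure.Portmanteau
import HarnessLib

/-!
# Crux `MassiveWindowSLE` (stmt-CriticalPhenomena-7685), line `registered` (skeleton r5):
stub `stub_hullRestrictionOfDefect` — restriction defect + NoTouch + simple carriage ⇒ hull restriction

Route `SAWMassiveIsingTilt` of `CriticalPhenomena/SAWScalingLimit`; stub 2b (passage glue) of the line
`registered` (`Cruxes/MassiveWindowSLE/Lines/birth.lean`, r5). Objects: the window laws
`tiltLaw D.carrier δ (x δ) (1/√3 − m δ·δ) (a δ) (b δ)` (`Theorems/SAWMassiveIsingTiltDefs.lean`) pushed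
to `CurveClass ℂ` by `γ ↦ γ.curve`, their weak limits `P D`, a hull subdomain `D'` of `D`, the removed
hull `K = cl (D ∖ D')` (compact), `N = {γ ⊆ cl D'}`, `O_ε = {γ | ∀ z ∈ range γ, ∀ k ∈ K, ε < dist z k}`.

* `hrd_measure_inter_mul_le_of_tendstoLaw` — MODEL-FREE CORE: a two-sided asymptotic restriction
  identity with a multiplicative defect `c` on an open event `O` passes to weak limits as
  `μ (F ∩ O) · μ' (O) ≤ c² · μ (C) · μ' (F)` (`F` closed, `C ⊇ O` closed): the normalising constant is
  eliminated by a product, a sequence `δₙ → 0⁺` is extracted inside the eventuality sets, portmanteau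
  runs through `η`-thickenings (`ENNReal.le_liminf_mul`, `ENNReal.limsup_mul_le'`; the scheme of
  `SubseqIdentification.BoundaryAreaLaw.measure_inter_le_mul_of_tendsto`).
* `hrd_le_of_layer`, `hrd_le_of_forall_defect` — removing the `ε`-layer and the defect `θ → 0⁺`.
* `hrd_isOpen_avoid`, `hrd_isClosed_avoidLe`, `hrd_tendsto_measure_inter_compl_avoid` — `O_ε` is open,
  `{ε ≤ dist}` is closed, and `S ∖ O_{1/(k+1)}` has vanishing mass when `S ∩ {γ meets K}` is null
  (compactness of `range γ × K`: `hrd_range_inter_nonempty`; continuity from above).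
* `hrd_measure_touch_eq_zero`, `hrd_measure_avoidLe_le` — simple carriage in `D'` kills the `P D'`-mass
  touching `K` (`K ∩ cl D' ⊆ ∂D' ∖ {a, b}`); chordality gives `P D {ε ≤ dist} ≤ P D (N)`.
* `stub_hullRestrictionOfDefect` — the registered signature: `P D (F ∩ O_ε) P D' (O_ε) ≤ (1+θ)² P D (N)
  P D' (F)` for closed `F`; the layer is removed by NoTouch (`P D`-side) and simple carriage (`P D'`-side);
  the equal-mass upgrade (`SubseqIdentification.BoundaryAreaLaw.ext_of_forall_isClosed_le`) turns
  `P D (F ∩ N) ≤ P D (N) P D' (F)` into `P D' (T) · P D (N) = P D (T ∩ N)`. Fastness is not used.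

References: G. F. Lawler, O. Schramm, W. Werner, *Conformal restriction: the chordal case*, J. Amer.
Math. Soc. 16 (2003), §3; P. Billingsley, *Convergence of probability measures*, 2nd ed. (1999),
Thm. 2.1 (portmanteau). No named fact is used; axioms `propext`, `Classical.choice`, `Quot.sound`.
-/

noncomputable section

namespace Summit.CriticalPhenomena.SAWScalingLimit.Theorems.MassiveWindowSLE.Birth

open scoped Topology NNReal ENNReal BoundedContinuousFunction
open Filter Set MeasureTheory Metric
open Literature.Probability Literature.Probability.LatticeModels
  Literature.Probability.RandomPlanarGeometry

/-- **Two-sided asymptotic restriction with a layer passes to weak limits.** `Y δ`, `Y' δ` under laws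
`P δ`, `P' δ` (eventually probability measures) converge in law along `𝓝[>] 0` to the probability
measures `μ`, `μ'`; `O` open, `C ⊇ O` closed, `c < ∞`; eventually one constant `q` gives
`law(Y δ)(B ∩ O) ≤ c q law(Y' δ)(B ∩ O)` and `q law(Y' δ)(B ∩ O) ≤ c law(Y δ)(B ∩ O)` (Borel `B`). Then
`μ (F ∩ O) · μ' (O) ≤ c² · μ (C) · μ' (F)` for closed `F`: eliminate `q` (first inequality at `B` times
the second at `univ`), pass to a sequence `δₙ → 0⁺` inside the eventuality sets, and for `η > 0`,
`μ(F ∩ O) μ'(O) ≤ liminf νₙ(F^η ∩ O) · liminf ν'ₙ(O) ≤ limsup c² νₙ(C) ν'ₙ(F̄^η) ≤ c² μ(C) μ'(F̄^η)`. -/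
theorem hrd_measure_inter_mul_le_of_tendstoLaw {X : Type*} [PseudoMetricSpace X] [MeasurableSpace X]
    [OpensMeasurableSpace X] {Ωδ : ℝ → Type*} {Ωδ' : ℝ → Type*} [∀ δ, MeasurableSpace (Ωδ δ)]
    [∀ δ, MeasurableSpace (Ωδ' δ)]
    {Y : ∀ δ, Ωδ δ → X} {Y' : ∀ δ, Ωδ' δ → X}
    {P : ∀ δ, Measure (Ωδ δ)} {P' : ∀ δ, Measure (Ωδ' δ)} {μ μ' : Measure X}
    [hμ : IsProbabilityMeasure μ] [hμ' : IsProbabilityMeasure μ']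
    (hY : ∀ δ, Measurable (Y δ)) (hY' : ∀ δ, Measurable (Y' δ))
    (hP : ∀ᶠ δ in 𝓝[>] (0 : ℝ), IsProbabilityMeasure (P δ))
    (hP' : ∀ᶠ δ in 𝓝[>] (0 : ℝ), IsProbabilityMeasure (P' δ))
    (hlim : TendstoLaw Y P id μ) (hlim' : TendstoLaw Y' P' id μ')
    {O C : Set X} (hO : IsOpen O) (hC : IsClosed C) (hOC : O ⊆ C) {c : ℝ≥0∞} (hc : c ≠ ∞)
    (hdef : ∀ᶠ δ in 𝓝[>] (0 : ℝ), ∃ q : ℝ≥0∞, ∀ B : Set X, MeasurableSet B →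
      (P δ).map (Y δ) (B ∩ O) ≤ c * q * (P' δ).map (Y' δ) (B ∩ O) ∧
        q * (P' δ).map (Y' δ) (B ∩ O) ≤ c * (P δ).map (Y δ) (B ∩ O))
    {F : Set X} (hF : IsClosed F) :
    μ (F ∩ O) * μ' O ≤ c * c * μ C * μ' F := by
  -- a sequence `s n → 0⁺` along which all three eventualities hold; the image laws along it
  obtain ⟨s, hs, hgood⟩ := exists_seq_forall_of_frequently (hP.and (hP'.and hdef)).frequently
  set ν : ℕ → Measure X := fun n => (P (s n)).map (Y (s n))
  set ν' : ℕ → Measure X := fun n => (P' (s n)).map (Y' (s n))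
  have hνp : ∀ n, IsProbabilityMeasure (ν n) := fun n => by
    haveI := (hgood n).1; exact Measure.isProbabilityMeasure_map (hY _).aemeasurable
  have hν'p : ∀ n, IsProbabilityMeasure (ν' n) := fun n => by
    haveI := (hgood n).2.1; exact Measure.isProbabilityMeasure_map (hY' _).aemeasurable
  have hν : Tendsto (β := ProbabilityMeasure X) (fun n => ⟨ν n, hνp n⟩) atTop (𝓝 ⟨μ, hμ⟩) := by
    refine ProbabilityMeasure.tendsto_iff_forall_integral_tendsto.2 fun f => ?_
    refine ((hlim f).comp hs).congr fun n => ?_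
    exact (integral_map (hY _).aemeasurable f.continuous.aestronglyMeasurable).symm
  have hν' : Tendsto (β := ProbabilityMeasure X) (fun n => ⟨ν' n, hν'p n⟩) atTop (𝓝 ⟨μ', hμ'⟩) := by
    refine ProbabilityMeasure.tendsto_iff_forall_integral_tendsto.2 fun f => ?_
    refine ((hlim' f).comp hs).congr fun n => ?_
    exact (integral_map (hY' _).aemeasurable f.continuous.aestronglyMeasurable).symm
  -- `q` eliminated: the product inequality along the sequence
  have hineq : ∀ (n) (B : Set X), MeasurableSet B →
      ν n (B ∩ O) * ν' n O ≤ c * c * (ν n C * ν' n B) := by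
    intro n B hB
    obtain ⟨q, hq⟩ := (hgood n).2.2
    have h2 := (hq univ MeasurableSet.univ).2
    rw [univ_inter] at h2
    calc ν n (B ∩ O) * ν' n O ≤ c * q * ν' n (B ∩ O) * ν' n O := mul_le_mul_left (hq B hB).1 _
      _ = c * ν' n (B ∩ O) * (q * ν' n O) := by ring
      _ ≤ c * ν' n B * (c * ν n C) :=
          mul_le_mul' (mul_le_mul_right (measure_mono inter_subset_left) _)
            (h2.trans (mul_le_mul_right (measure_mono hOC) _))
      _ = c * c * (ν n C * ν' n B) := by ring
  -- portmanteau through the `η`-thickenings of `F`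
  have key : ∀ η : ℝ, 0 < η → μ (F ∩ O) * μ' O ≤ c * c * μ C * μ' (cthickening η F) := by
    intro η hη
    have h3 : limsup (fun n => ν n C) atTop ≤ μ C :=
      ProbabilityMeasure.limsup_measure_closed_le_of_tendsto hν hC
    have h4 : limsup (fun n => ν' n (cthickening η F)) atTop ≤ μ' (cthickening η F) :=
      ProbabilityMeasure.limsup_measure_closed_le_of_tendsto hν' isClosed_cthickening
    calc μ (F ∩ O) * μ' O ≤ μ (thickening η F ∩ O) * μ' O :=
          mul_le_mul_left (measure_mono (inter_subset_inter_left _ (self_subset_thickening hη F))) _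
      _ ≤ liminf (fun n => ν n (thickening η F ∩ O)) atTop * liminf (fun n => ν' n O) atTop :=
          mul_le_mul' (ProbabilityMeasure.le_liminf_measure_open_of_tendsto hν
            (isOpen_thickening.inter hO)) (ProbabilityMeasure.le_liminf_measure_open_of_tendsto hν' hO)
      _ ≤ liminf (fun n => ν n (thickening η F ∩ O) * ν' n O) atTop := ENNReal.le_liminf_mul
      _ ≤ liminf (fun n => c * c * (ν n C * ν' n (cthickening η F))) atTop :=
          liminf_le_liminf (Eventually.of_forall fun n => (mul_le_mul_left (measure_mono
            (inter_subset_inter_left _ (thickening_subset_cthickening η F))) _).trans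
              (hineq n _ isClosed_cthickening.measurableSet))
      _ ≤ limsup (fun n => c * c * (ν n C * ν' n (cthickening η F))) atTop := liminf_le_limsup
      _ = c * c * limsup (fun n => ν n C * ν' n (cthickening η F)) atTop :=
          ENNReal.limsup_const_mul_of_ne_top (ENNReal.mul_ne_top hc hc)
      _ ≤ c * c * (limsup (fun n => ν n C) atTop * limsup (fun n => ν' n (cthickening η F)) atTop) :=
          mul_le_mul_right (ENNReal.limsup_mul_le' (Or.inr (h4.trans_lt (measure_lt_top _ _)).ne)
            (Or.inl (h3.trans_lt (measure_lt_top _ _)).ne)) _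
      _ ≤ c * c * (μ C * μ' (cthickening η F)) := mul_le_mul_right (mul_le_mul' h3 h4) _
      _ = c * c * μ C * μ' (cthickening η F) := (mul_assoc _ _ _).symm
  -- let `η → 0⁺`
  have hlimη : Tendsto (fun η : ℝ => c * c * μ C * μ' (cthickening η F)) (𝓝[>] 0)
      (𝓝 (c * c * μ C * μ' F)) :=
    (ENNReal.Tendsto.const_mul (tendsto_measure_cthickening_of_isClosed
      ⟨1, one_pos, measure_ne_top _ _⟩ hF) (Or.inr (ENNReal.mul_ne_top (ENNReal.mul_ne_top hc hc)
        (measure_ne_top _ _)))).mono_left nhdsWithin_le_nhds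
  exact ge_of_tendsto hlimη (eventually_nhdsWithin_of_forall fun η hη => key η hη)

/-- **Removing the layer.** If `x ≤ y k + a k`, `1 ≤ z k + b k`, `y k · z k ≤ R`, `z k ≤ 1` for all
`k`, with `a k → 0`, `b k → 0` and `x < ∞`, then `x ≤ R`: `x (1 - b k) ≤ (y k + a k) z k ≤ R + a k`. -/
theorem hrd_le_of_layer {x R : ℝ≥0∞} (hx : x ≠ ∞) {y z a b : ℕ → ℝ≥0∞}
    (h1 : ∀ k, x ≤ y k + a k) (h2 : ∀ k, 1 ≤ z k + b k) (h3 : ∀ k, y k * z k ≤ R)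
    (hz : ∀ k, z k ≤ 1) (ha : Tendsto a atTop (𝓝 0)) (hb : Tendsto b atTop (𝓝 0)) : x ≤ R := by
  have hk : ∀ k, x * (1 - b k) ≤ R + a k := fun k =>
    calc x * (1 - b k) ≤ x * z k := mul_le_mul_right (tsub_le_iff_right.2 (h2 k)) _
      _ ≤ (y k + a k) * z k := mul_le_mul_left (h1 k) _
      _ = y k * z k + a k * z k := add_mul _ _ _
      _ ≤ R + a k * 1 := add_le_add (h3 k) (mul_le_mul_right (hz k) _)
      _ = R + a k := by rw [mul_one]
  have hl : Tendsto (fun k => x * (1 - b k)) atTop (𝓝 (x * (1 - 0))) :=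
    ENNReal.Tendsto.const_mul (ENNReal.Tendsto.sub tendsto_const_nhds hb
      (Or.inl ENNReal.one_ne_top)) (Or.inr hx)
  have h := le_of_tendsto_of_tendsto' hl (tendsto_const_nhds.add ha) hk
  simpa using h

/-- **Removing the multiplicative defect.** If `u ≤ (1 + θ)² v` for every `θ > 0` then `u ≤ v`
(`(1 + θ)² → 1` as `θ → 0⁺`, in `ℝ≥0∞`). -/
theorem hrd_le_of_forall_defect {u v : ℝ≥0∞}
    (h : ∀ θ : ℝ, 0 < θ → u ≤ ENNReal.ofReal (1 + θ) * ENNReal.ofReal (1 + θ) * v) : u ≤ v := by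
  have h1 : Tendsto (fun θ : ℝ => ENNReal.ofReal (1 + θ)) (𝓝[>] 0) (𝓝 1) := by
    have h0 : Tendsto (fun θ : ℝ => ENNReal.ofReal (1 + θ)) (𝓝 0) (𝓝 (ENNReal.ofReal (1 + 0))) :=
      ENNReal.tendsto_ofReal (tendsto_const_nhds.add tendsto_id)
    rw [add_zero, ENNReal.ofReal_one] at h0
    exact h0.mono_left nhdsWithin_le_nhds
  have h2 : Tendsto (fun θ : ℝ => ENNReal.ofReal (1 + θ) * ENNReal.ofReal (1 + θ) * v) (𝓝[>] 0)
      (𝓝 (1 * 1 * v)) :=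
    ENNReal.Tendsto.mul_const (ENNReal.Tendsto.mul h1 (Or.inl one_ne_zero) h1
      (Or.inl one_ne_zero)) (Or.inl (by norm_num))
  rw [one_mul, one_mul] at h2
  exact ge_of_tendsto h2 (eventually_nhdsWithin_of_forall h)

/-- The event "the trace stays at distance `> ε` from the compact set `K`" is open in the curve
space: for `K ≠ ∅` it is the range-subset event of the OPEN set `{z | ε < infDist z K}` (the infimum
over `K` is attained), open by `CurveClass.isClosed_hitsBefore_empty_right`; for `K = ∅` it is `univ`. -/
theorem hrd_isOpen_avoid {K : Set ℂ} (hK : IsCompact K) (ε : ℝ) :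
    IsOpen {γ : CurveClass ℂ | ∀ z ∈ γ.range, ∀ k ∈ K, ε < dist z k} := by
  rcases K.eq_empty_or_nonempty with rfl | hne
  · rw [Set.eq_univ_of_forall fun (γ : CurveClass ℂ) z (_ : z ∈ γ.range) k (hk : k ∈ (∅ : Set ℂ)) =>
      (Set.notMem_empty k hk).elim]
    exact isOpen_univ
  · have hU : {γ : CurveClass ℂ | ∀ z ∈ γ.range, ∀ k ∈ K, ε < dist z k} =
        CurveClass.rangeSubset {z : ℂ | ε < infDist z K} := by
      ext γ
      simp only [CurveClass.mem_rangeSubset, Set.subset_def, Set.mem_setOf_eq]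
      refine forall₂_congr fun z _ => ⟨fun h => ?_, fun h k hk => h.trans_le (infDist_le_dist_of_mem hk)⟩
      obtain ⟨y, hy, hyd⟩ := hK.exists_infDist_eq_dist hne z
      rw [hyd]
      exact h y hy
    have hcl := CurveClass.isClosed_hitsBefore_empty_right
      (isOpen_lt continuous_const (continuous_infDist_pt K) :
        IsOpen {z : ℂ | ε < infDist z K}).isClosed_compl
    rw [CurveClass.hitsBefore_empty_right, compl_compl] at hcl
    rw [hU]
    exact isClosed_compl_iff.1 hcl

/-- The event "the trace stays at distance `≥ ε` from `K`" is closed in the curve space: it is the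
range-subset event of the closed set `⋂ k ∈ K, {z | ε ≤ dist z k}` (`CurveClass.isClosed_rangeSubset`). -/
theorem hrd_isClosed_avoidLe (K : Set ℂ) (ε : ℝ) :
    IsClosed {γ : CurveClass ℂ | ∀ z ∈ γ.range, ∀ k ∈ K, ε ≤ dist z k} := by
  have h : {γ : CurveClass ℂ | ∀ z ∈ γ.range, ∀ k ∈ K, ε ≤ dist z k} =
      CurveClass.rangeSubset (⋂ k ∈ K, {z : ℂ | ε ≤ dist z k}) := by
    ext γ
    simp only [CurveClass.mem_rangeSubset, Set.subset_def, Set.mem_setOf_eq, Set.mem_iInter]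
  rw [h]
  exact CurveClass.isClosed_rangeSubset (isClosed_biInter fun k _ =>
    isClosed_le continuous_const (continuous_id.dist continuous_const))

/-- **Approaching a compact set at every scale means touching it**: if for every `n` some point of
the trace of `γ` is within `1/(n+1)` of the compact `K`, the trace meets `K` (the distance function
attains its minimum on the compact `range γ × K`, and that minimum is `0`). -/
theorem hrd_range_inter_nonempty {K : Set ℂ} (hK : IsCompact K) (γ : CurveClass ℂ)
    (h : ∀ n : ℕ, ∃ z ∈ γ.range, ∃ w ∈ K, dist z w ≤ 1 / ((n : ℝ) + 1)) :
    (γ.range ∩ K).Nonempty := by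
  obtain ⟨z₀, hz₀, w₀, hw₀, -⟩ := h 0
  obtain ⟨p, hp, hmin⟩ := (γ.isCompact_range.prod hK).exists_isMinOn ⟨(z₀, w₀), hz₀, hw₀⟩
    continuous_dist.continuousOn
  have hle : ∀ n : ℕ, dist p.1 p.2 ≤ 1 / ((n : ℝ) + 1) := fun n => by
    obtain ⟨z, hz, w, hw, hzw⟩ := h n
    exact (isMinOn_iff.1 hmin (z, w) ⟨hz, hw⟩).trans hzw
  refine ⟨p.1, hp.1, ?_⟩
  rw [dist_le_zero.1 (ge_of_tendsto' tendsto_one_div_add_atTop_nhds_zero_nat hle)]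
  exact hp.2

/-- **The layer vanishes as `ε → 0⁺`.** For a finite measure `μ` on the curve space, a compact `K`
and a Borel `S` with `μ (S ∩ {trace meets K}) = 0`, the `μ`-mass of the curves of `S` coming
`1/(k+1)`-close to `K` tends to `0` (continuity from above along the decreasing closed layers,
whose intersection lies in the touching event by `hrd_range_inter_nonempty`). -/
theorem hrd_tendsto_measure_inter_compl_avoid {μ : Measure (CurveClass ℂ)} [IsFiniteMeasure μ]
    {K : Set ℂ} (hK : IsCompact K) {S : Set (CurveClass ℂ)} (hS : MeasurableSet S)
    (h0 : μ (S ∩ {γ | (γ.range ∩ K).Nonempty}) = 0) :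
    Tendsto (fun k : ℕ => μ (S ∩ {γ : CurveClass ℂ | ∀ z ∈ γ.range, ∀ w ∈ K,
      1 / ((k : ℝ) + 1) < dist z w}ᶜ)) atTop (𝓝 0) := by
  set L : ℕ → Set (CurveClass ℂ) := fun k => S ∩ {γ : CurveClass ℂ | ∀ z ∈ γ.range, ∀ w ∈ K,
    1 / ((k : ℝ) + 1) < dist z w}ᶜ
  have hmeas : ∀ k, NullMeasurableSet (L k) μ := fun k =>
    (hS.inter (hrd_isOpen_avoid hK _).isClosed_compl.measurableSet).nullMeasurableSet
  have hant : Antitone L := fun k l hkl => inter_subset_inter_right _ (compl_subset_compl.2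
    fun γ hγ z hz w hw => (Nat.one_div_le_one_div hkl).trans_lt (hγ z hz w hw))
  have hnull : μ (⋂ k, L k) = 0 := by
    refine measure_mono_null (fun γ hγ => ?_) h0
    rw [mem_iInter] at hγ
    refine ⟨(hγ 0).1, hrd_range_inter_nonempty hK γ fun k => ?_⟩
    have hk := (hγ k).2
    simp only [mem_compl_iff, mem_setOf_eq, not_forall, not_lt] at hk
    obtain ⟨z, hz, w, hw, hzw⟩ := hk
    exact ⟨z, hz, w, hw, hzw⟩
  have ht := tendsto_measure_iInter_atTop hmeas hant ⟨0, measure_ne_top _ _⟩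
  rw [hnull] at ht
  exact ht

/-- Under a chordal family carried by simple curves, in a hull subdomain `D'` of `D` almost no curve
touches the removed hull `cl (D ∖ D')`: a touching point lies in `cl D'` and not in the open `D'`
(which misses `cl (D ∖ D')`), hence on `∂D'`, hence is a marked point — but the marked points are off
`cl (D ∖ D')` (`IsHullSubdomain.pt_zero_notMem` / `pt_one_notMem`). -/
theorem hrd_measure_touch_eq_zero {P : ChordalFamily} (hP : P.IsChordal)
    (hS : P.IsCarriedBySimpleCurves) {D D' : DobrushinDomain} (hDD' : D.IsHullSubdomain D') :
    P D' {γ | (γ.range ∩ closure (D.carrier \ D'.carrier)).Nonempty} = 0 := by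
  rw [measure_eq_zero_iff_ae_notMem]
  filter_upwards [(hP D').2, hS D'] with γ hc hs
  rintro ⟨z, hz, hzK⟩
  have hzfr : z ∈ frontier D'.carrier := by
    rw [D'.isOpen.frontier_eq]
    exact ⟨hc.2.2 hz, closure_minimal (fun w hw => hw.2) D'.isOpen.isClosed_compl hzK⟩
  rcases hs.2 ⟨hz, hzfr⟩ with h | h
  · apply hDD'.pt_zero_notMem
    rw [← hDD'.pt_zero_eq, ← h]
    exact hzK
  · have h' : z = D'.pt 1 := h
    apply hDD'.pt_one_notMem
    rw [← hDD'.pt_one_eq, ← h']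
    exact hzK

/-- Under a chordal family, for `ε > 0` the event "the trace stays at distance `≥ ε` from `cl (D ∖ D')`"
is `P D`-almost contained in "the trace lies in `cl D'`": almost surely the trace lies in
`cl D ⊆ cl D' ∪ cl (D ∖ D')`, and a point of `cl (D ∖ D')` is at distance `0` from it. -/
theorem hrd_measure_avoidLe_le {P : ChordalFamily} (hP : P.IsChordal) (D D' : DobrushinDomain)
    {ε : ℝ} (hε : 0 < ε) :
    P D {γ | ∀ z ∈ γ.range, ∀ k ∈ closure (D.carrier \ D'.carrier), ε ≤ dist z k} ≤
      P D (CurveClass.rangeSubset (closure D'.carrier)) := by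
  refine measure_mono_ae ?_
  filter_upwards [(hP D).2] with γ hc hC z hz
  have hcl : closure D.carrier ⊆ closure D'.carrier ∪ closure (D.carrier \ D'.carrier) := by
    rw [← closure_union]
    exact closure_mono fun w hw => (em (w ∈ D'.carrier)).elim Or.inl fun h => Or.inr ⟨hw, h⟩
  refine (hcl (hc.2.2 hz)).elim id fun h => absurd (hC z hz z h) (not_le.2 ?_)
  rwa [dist_self]

/-- If the tilted interface laws converge in law to a probability measure, they are eventually
probability measures: the total mass `Z⁻¹ Z` is `0` or `1` (junk conventions `0⁻¹ · 0 = ∞⁻¹ · ∞ = 0`)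
and tends to `1` (test `TendstoLaw` at the constant function `1`). -/
theorem hrd_eventually_isProbabilityMeasure_tiltLaw {Ω : Set ℂ} {a b : ℝ → HexVertex}
    {x y : ℝ → ℝ} {μ : Measure (CurveClass ℂ)} [IsProbabilityMeasure μ]
    (h : TendstoLaw (fun δ (γ : SAW.HexDomainSAW Ω δ (a δ) (b δ)) => γ.curve)
      (fun δ => SAWMassiveIsingTilt.tiltLaw Ω δ (x δ) (y δ) (a δ) (b δ)) id μ) :
    ∀ᶠ δ in 𝓝[>] (0 : ℝ),
      IsProbabilityMeasure (SAWMassiveIsingTilt.tiltLaw Ω δ (x δ) (y δ) (a δ) (b δ)) := by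
  have h1 := h 1
  simp only [BoundedContinuousFunction.coe_one, Pi.one_apply, integral_const, smul_eq_mul,
    mul_one, probReal_univ] at h1
  filter_upwards [h1.eventually (lt_mem_nhds (show (1 : ℝ) / 2 < 1 by norm_num))] with δ hδ
  have h01 : SAWMassiveIsingTilt.tiltLaw Ω δ (x δ) (y δ) (a δ) (b δ) univ = 0 ∨
      SAWMassiveIsingTilt.tiltLaw Ω δ (x δ) (y δ) (a δ) (b δ) univ = 1 := by
    rw [SAWMassiveIsingTilt.tiltLaw, Measure.smul_apply, smul_eq_mul]
    by_cases h0 : SAWMassiveIsingTilt.tilt Ω δ (x δ) (y δ) (a δ) (b δ) univ = 0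
    · exact Or.inl (by rw [h0, mul_zero])
    by_cases ht : SAWMassiveIsingTilt.tilt Ω δ (x δ) (y δ) (a δ) (b δ) univ = ∞
    · exact Or.inl (by rw [ht, ENNReal.inv_top, zero_mul])
    exact Or.inr (ENNReal.inv_mul_cancel h0 ht)
  rcases h01 with h0 | h0
  · rw [measureReal_def, h0, ENNReal.toReal_zero] at hδ
    norm_num at hδ
  · exact ⟨h0⟩

/-- **Stub 2b (passage glue): restriction defect + NoTouch ⇒ hull restriction.** Given common
endpoint approximations of hull pairs (stub C), a fast window schedule with window-limit family `P`
that is chordal, carried by simple curves and NoTouch, and the two-sided defect of stub 2a for this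
schedule, `P` has two-sided restriction over hull subdomains:
`P D' (T) · P D {γ ⊆ cl D'} = P D (T ∩ {γ ⊆ cl D'})`. Proof: for closed `F`, every layer `ε > 0` and
defect `θ > 0`, portmanteau along a sequence `δₙ → 0⁺` of probability window laws turns the lattice
inequalities into `P D (F ∩ O_ε) · P D' (O_ε) ≤ (1+θ)² P D (N) P D' (F)`
(`hrd_measure_inter_mul_le_of_tendstoLaw`, `hrd_measure_avoidLe_le`); the layer is removed by NoTouch
(`P D`-side) and simple carriage in `D'` (`P D'`-side, `hrd_measure_touch_eq_zero`) through continuity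
from above (`hrd_tendsto_measure_inter_compl_avoid`, `hrd_le_of_layer`), giving
`P D (F ∩ N) ≤ P D (N) P D' (F)` for closed `F`; equal mass of `P D (N) • P D'` and `P D |_N` gives the
identity (`SubseqIdentification.BoundaryAreaLaw.ext_of_forall_isClosed_le`). -/
theorem stub_hullRestrictionOfDefect :
    (∀ D D' : Literature.Probability.RandomPlanarGeometry.DobrushinDomain, D.IsHullSubdomain D' → ∃ a b : ℝ → Literature.Probability.LatticeModels.HexVertex, Literature.Probability.RandomPlanarGeometry.SAW.IsEmbEndpointApprox Literature.Probability.LatticeModels.hexGraph Literature.Probability.LatticeModels.hexCenter D a b ∧ Literature.Probability.RandomPlanarGeometry.SAW.IsEmbEndpointApprox Literature.Probability.LatticeModels.hexGraph Literature.Probability.LatticeModels.hexCenter D' a b) → ∀ (m x : ℝ → ℝ) (P : Literature.Probability.RandomPlanarGeometry.ChordalFamily), (Filter.Tendsto (fun δ => m δ * δ) (nhdsWithin 0 (Set.Ioi 0)) (nhds 0) ∧ Filter.Tendsto (fun δ => m δ / Real.log δ⁻¹) (nhdsWithin 0 (Set.Ioi 0)) Filter.atTop ∧ ∀ (D : Literature.Probability.RandomPlanarGeometry.DobrushinDomain)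 (a b : ℝ → Literature.Probability.LatticeModels.HexVertex), Literature.Probability.RandomPlanarGeometry.SAW.IsEmbEndpointApprox Literature.Probability.LatticeModels.hexGraph Literature.Probability.LatticeModels.hexCenter D a b → Literature.Probability.RandomPlanarGeometry.TendstoLaw (fun δ (γ : Literature.Probability.RandomPlanarGeometry.SAW.HexDomainSAW D.carrier δ (a δ) (b δ)) => γ.curve) (fun δ => Summit.CriticalPhenomena.SAWScalingLimit.Theorems.SAWMassiveIsingTilt.tiltLaw D.carrier δ (x δ) ((Real.sqrt 3)⁻¹ - m δ * δ) (a δ) (b δ)) id (P D)) → P.IsChordal → P.IsCarriedBySimpleCurves → (∀ D D' : Literature.Probability.RandomPlanarGeometry.DobrushinDomain, D.IsHullSubdomain D' → P D {γ | γ.range ⊆ closure D'.carrier ∧ (γ.range ∩ closure (D.carrier \ D'.carrier)).Nonempty} = 0) → (∀ (D D' : Literature.Probability.RandomPlanarGeometry.DobrushinDomain), D.IsHullSubdomain D' → ∀ (a b : ℝ → Literature.Probability.LatticeModels.HexVertex), Literature.Probability.RandomPlanarGeometry.SAW.IsEmbEndpointApprox Literature.Probability.LatticeModels.hexGraph Literature.Probability.LatticeModels.hexCenter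 D a b → Literature.Probability.RandomPlanarGeometry.SAW.IsEmbEndpointApprox Literature.Probability.LatticeModels.hexGraph Literature.Probability.LatticeModels.hexCenter D' a b → ∀ ε : ℝ, 0 < ε → ∀ θ : ℝ, 0 < θ → ∀ᶠ δ in nhdsWithin 0 (Set.Ioi 0), ∃ q : NNReal, ∀ B : Set (Literature.Probability.RandomPlanarGeometry.CurveClass ℂ), MeasurableSet B → (MeasureTheory.Measure.map (fun γ : Literature.Probability.RandomPlanarGeometry.SAW.HexDomainSAW D.carrier δ (a δ) (b δ) => γ.curve) (Summit.CriticalPhenomena.SAWScalingLimit.Theorems.SAWMassiveIsingTilt.tiltLaw D.carrier δ (x δ) ((Real.sqrt 3)⁻¹ - m δ * δ) (a δ) (b δ))) (B ∩ {γ : Literature.Probability.RandomPlanarGeometry.CurveClass ℂ | ∀ z ∈ γ.range, ∀ k ∈ closure (D.carrier \ D'.carrier), ε < dist z k}) ≤ ENNReal.ofReal (1 + θ) * (q : ENNReal) * (MeasureTheory.Measure.map (fun γ : Literature.Probability.RandomPlanarGeometry.SAW.HexDomainSAW D'.carrier δ (a δ) (b δ) => γ.curve) (Summit.CriticalPhenomena.SAWScalingLimit.Theorems.SAWMassiveIsingTilt.tiltLaw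 D'.carrier δ (x δ) ((Real.sqrt 3)⁻¹ - m δ * δ) (a δ) (b δ))) (B ∩ {γ : Literature.Probability.RandomPlanarGeometry.CurveClass ℂ | ∀ z ∈ γ.range, ∀ k ∈ closure (D.carrier \ D'.carrier), ε < dist z k}) ∧ (q : ENNReal) * (MeasureTheory.Measure.map (fun γ : Literature.Probability.RandomPlanarGeometry.SAW.HexDomainSAW D'.carrier δ (a δ) (b δ) => γ.curve) (Summit.CriticalPhenomena.SAWScalingLimit.Theorems.SAWMassiveIsingTilt.tiltLaw D'.carrier δ (x δ) ((Real.sqrt 3)⁻¹ - m δ * δ) (a δ) (b δ))) (B ∩ {γ : Literature.Probability.RandomPlanarGeometry.CurveClass ℂ | ∀ z ∈ γ.range, ∀ k ∈ closure (D.carrier \ D'.carrier), ε < dist z k}) ≤ ENNReal.ofReal (1 + θ) * (MeasureTheory.Measure.map (fun γ : Literature.Probability.RandomPlanarGeometry.SAW.HexDomainSAW D.carrier δ (a δ) (b δ) => γ.curve) (Summit.CriticalPhenomena.SAWScalingLimit.Theorems.SAWMassiveIsingTilt.tiltLaw D.carrier δ (x δ) ((Real.sqrt 3)⁻¹ - m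 δ * δ) (a δ) (b δ))) (B ∩ {γ : Literature.Probability.RandomPlanarGeometry.CurveClass ℂ | ∀ z ∈ γ.range, ∀ k ∈ closure (D.carrier \ D'.carrier), ε < dist z k})) → P.IsHullRestriction := by
  intro hCommon m x P hconv hP hS hNT hDef D D' hDD' T hT
  obtain ⟨-, -, hconv⟩ := hconv
  obtain ⟨a, b, hab, hab'⟩ := hCommon D D' hDD'
  haveI hμ : IsProbabilityMeasure (P D) := (hP D).1
  haveI hμ' : IsProbabilityMeasure (P D') := (hP D').1
  have hKc : IsCompact (closure (D.carrier \ D'.carrier)) :=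
    isCompact_of_isClosed_isBounded isClosed_closure (D.isBounded.subset fun _ h => h.1).closure
  have hNcl : IsClosed (CurveClass.rangeSubset (closure D'.carrier) : Set (CurveClass ℂ)) :=
    CurveClass.isClosed_rangeSubset isClosed_closure
  -- the closed-set inequality `P D (F ∩ N) ≤ P D N · P D' F`
  have hclosed : ∀ F : Set (CurveClass ℂ), IsClosed F →
      P D (F ∩ CurveClass.rangeSubset (closure D'.carrier)) ≤
        P D (CurveClass.rangeSubset (closure D'.carrier)) * P D' F := by
    intro F hF
    -- one layer `ε > 0`: the product inequality, defect removed
    have hcore : ∀ ε : ℝ, 0 < ε →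
        P D (F ∩ {γ : CurveClass ℂ | ∀ z ∈ γ.range, ∀ k ∈ closure (D.carrier \ D'.carrier),
            ε < dist z k}) *
          P D' {γ : CurveClass ℂ | ∀ z ∈ γ.range, ∀ k ∈ closure (D.carrier \ D'.carrier),
            ε < dist z k} ≤
          P D (CurveClass.rangeSubset (closure D'.carrier)) * P D' F := by
      intro ε hε
      refine hrd_le_of_forall_defect fun θ hθ => ?_
      have h := hrd_measure_inter_mul_le_of_tendstoLaw (μ := P D) (μ' := P D')
        (fun δ => SAW.EmbDomainSAW.measurable_of_top _)
        (fun δ => SAW.EmbDomainSAW.measurable_of_top _)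
        (hrd_eventually_isProbabilityMeasure_tiltLaw (hconv D a b hab))
        (hrd_eventually_isProbabilityMeasure_tiltLaw (hconv D' a b hab'))
        (hconv D a b hab) (hconv D' a b hab') (hrd_isOpen_avoid hKc ε)
        (hrd_isClosed_avoidLe (closure (D.carrier \ D'.carrier)) ε)
        (fun γ hγ z hz w hw => (hγ z hz w hw).le) (c := ENNReal.ofReal (1 + θ))
        ENNReal.ofReal_ne_top
        ((hDef D D' hDD' a b hab hab' ε hε θ hθ).mono fun δ ⟨q, hq⟩ =>
          ⟨(q : ℝ≥0∞), fun B hB => hq B hB⟩) hF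
      calc _ ≤ _ := h
        _ ≤ _ := by
          rw [mul_assoc]
          exact mul_le_mul_right (mul_le_mul_left (hrd_measure_avoidLe_le hP D D' hε) _) _
    refine hrd_le_of_layer (measure_ne_top _ _) (fun k => ?_) (fun k => ?_)
      (fun k : ℕ => hcore (1 / ((k : ℝ) + 1)) Nat.one_div_pos_of_nat) (fun k => prob_le_one)
      (hrd_tendsto_measure_inter_compl_avoid (μ := P D) hKc hNcl.measurableSet ?_)
      (hrd_tendsto_measure_inter_compl_avoid (μ := P D') hKc MeasurableSet.univ ?_)
    · -- `F ∩ N ⊆ (F ∩ O_k) ∪ (N ∖ O_k)`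
      exact (measure_mono fun γ hγ => (em _).elim (fun h => Or.inl ⟨hγ.1, h⟩)
        fun h => Or.inr ⟨hγ.2, h⟩).trans (measure_union_le _ _)
    · -- `1 = P D' (O_k) + P D' (O_kᶜ)`
      rw [univ_inter, measure_add_measure_compl (hrd_isOpen_avoid hKc _).measurableSet,
        measure_univ]
    · -- NoTouch: `P D (N ∩ {trace meets cl (D ∖ D')}) = 0`
      refine measure_mono_null (fun γ hγ => ?_) (hNT D D' hDD')
      exact ⟨hγ.1, hγ.2⟩
    · -- simple carriage in `D'`: `P D' {trace meets cl (D ∖ D')} = 0`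
      rw [univ_inter]
      exact hrd_measure_touch_eq_zero hP hS hDD'
  -- equal mass: `P D (N) • P D' = P D |_N` (adapted from `…RestrictionPassage.stub_restrictionPassage`)
  haveI : IsFiniteMeasure (P D (CurveClass.rangeSubset (closure D'.carrier)) • P D') :=
    Measure.smul_finite _ (measure_ne_top _ _)
  have heq : P D (CurveClass.rangeSubset (closure D'.carrier)) • P D' =
      (P D).restrict (CurveClass.rangeSubset (closure D'.carrier)) :=
    SubseqIdentification.BoundaryAreaLaw.ext_of_forall_isClosed_le
      (by rw [Measure.smul_apply, smul_eq_mul, measure_univ, mul_one, Measure.restrict_apply_univ])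
      fun F hF => by
        rw [Measure.restrict_apply hF.measurableSet, Measure.smul_apply, smul_eq_mul]
        exact hclosed F hF
  have h' := congrArg (fun ρ : Measure (CurveClass ℂ) => ρ T) heq
  simp only [Measure.smul_apply, smul_eq_mul, Measure.restrict_apply hT] at h'
  rw [mul_comm, h']

end Summit.CriticalPhenomena.SAWScalingLimit.Theorems.MassiveWindowSLE.Birth

end
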